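import Literature.AlgebraicGeometry.Frobenioids.PadicKummerGaloisChart
import Literature.AlgebraicGeometry.Frobenioids.PadicFieldwiseSaturatedGaloisBase
import Literature.AlgebraicGeometry.Frobenioids.QuasiTemperoidGaloisFieldsEquivalence
import Literature.AlgebraicGeometry.Frobenioids.PadicFrobenioidThm12TypesProofs
import HarnessLib

/-!
# Frobenioids II, Def. 2.2 (i) for the base of §2: the Galois chart of an object of a `p`-adic Frobenioid over
# the Galois-correspondence base `B(G_{ℚ_p})⁰ → D₀` (row (α), file D3b)

Mochizuki, *The geometry of Frobenioids II*, Kyushu J. Math. **62** (2008) 401–460, §2 p. 17 (setting: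
`D = B^temp(Π, Π°)⁰ → E = B^temp(G, G°)⁰`, `K` the finite extension of `ℚ_p` determined by `G`; here the case
`Π = G = G_{ℚ_p}` on the small model `CosetCat (G_{ℚ_p})` of abc-iut-w5-d229, `PadicFieldwiseSaturatedGaloisBase`),
Definition 2.2 (i) p. 17 ("`G_A ↪ Aut_E(A_E)`, which is an isomorphism if … `A_D` is Galois [… `C` is
`Aut`-ample — cf. Theorem 1.2, (i)]") [cite: MochizukiFrdII2008, Def 2.2 (i) p.17].

Definitions file (seat abc-iut-L1-t7, gen 4; GAP row G-L1t7-α, piece D3b). For a `p`-adic Frobenioid datum `d`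
over the base `CosetCat (G_{ℚ_p}) → D₀`, `U ↦ Spec ℚ̄_p^U` (`hd`, abc-iut-w5-d229's convention) and an object `A`
whose base `A_D = G_{ℚ_p}/U` has `U` NORMAL ("`A_D` is Galois"), we CONSTRUCT the Galois chart of file D2
(`GaloisChart d A ℚ_[p] (ℚ̄_p^U)`): `χ : K_A ≅ ℚ̄_p^U` is the identification carried by `hd`; `res α` is the
field automorphism `a ↦ g·a` of `Base(α⁻¹)` (abc-iut's `QuasiTemperoid.galoisFields`); its SURJECTIVITY is the
Galois correspondence (`galoisFields_full`, the bridge `CosetCat.toConnected` full and faithful) followed by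
`Aut`-ampleness ([FrdII] Thm. 1.2 (i), abc-iut-L1-t4's `thm12_isAutAmple`). Hence (`Def22Context.ofChart`, file
D3) every such object HAS a Definition 2.2 context that is an instance of abc-iut-L1-t7's Galois binding, and
Theorem 2.4 (i) (`thm24i_ofChart`) applies to it. Also recorded: `ℚ̄_p^U` is finite and normal over `ℚ_p`
(`normal_objField`). Nothing here concerns [IUTchIII]; classical Galois theory of `ℚ_p`; universe `0`.
-/

noncomputable section

namespace Literature.AlgebraicGeometry.Frobenioids

namespace PadicFrd

namespace Datum

open CategoryTheory Opposite Function Field IntermediateField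
open Literature.AnabelianGeometry.SemiGraphs
open Literature.AnabelianGeometry.SemiGraphs.CosetCat
open QuasiTemperoid

variable (p : ℕ) [Fact p.Prime]

/-- The Galois-correspondence base of §2 on its small model (abc-iut-w5-d229): `U ↦ Spec ℚ̄_p^U` with the
`p`-adic valuation, `CosetCat (G_{ℚ_p}) → D₀`. [cite: MochizukiFrdII2008, Def 2.2 (i) p.17] -/
abbrev galoisCosetBase : CosetCat (GalFbar ℚ_[p]) ⥤ PadicFld.{0} p :=
  CosetCat.toConnected (isTempered_galFbar ℚ_[p]) ⋙ galoisPadicFields p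

variable {p} (d : Datum (CosetCat (GalFbar ℚ_[p])) p) (hd : d.base = galoisCosetBase p) (A : d.frobenioid)

/-- The connected `G_{ℚ_p}`-set `A_D = G_{ℚ_p}/U` of the object `A`, in `B(G_{ℚ_p})⁰`.
[cite: MochizukiFrdII2008, Def 2.2 (i) p.17] -/
abbrev objConnected : ConnectedPart (BTemp (GalFbar ℚ_[p])) :=
  (CosetCat.toConnected (isTempered_galFbar ℚ_[p])).obj A.base

/-- **The field `K_A = ℚ̄_p^U` of the object** (`A_E = Spec K_A`), as an intermediate field of `ℚ̄_p/ℚ_p`.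
[cite: MochizukiFrdII2008, Rmk 2.2.1 p.18] -/
abbrev objField : IntermediateField ℚ_[p] (AlgebraicClosure ℚ_[p]) := fixFld ℚ_[p] (objConnected d A)

/-- `K_A` is finite over `ℚ_p`. [cite: MochizukiFrdII2008, Def 2.2 (i) p.17] -/
theorem finiteDimensional_objField : FiniteDimensional ℚ_[p] (objField d A) :=
  finiteDimensional_fixFld ℚ_[p] (objConnected d A)

/-- For `U` normal ("`A_D` is Galois"), `K_A = ℚ̄_p^U` is Galois over `ℚ_p` (Krull: the fixed field of a normal
closed subgroup is Galois, Mathlib `InfiniteGalois.normal_iff_isGalois`).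
[cite: MochizukiFrdII2008, Def 2.2 (ii) p.17] -/
theorem isGalois_objField (hA : A.base.sg.toSubgroup.Normal) : IsGalois ℚ_[p] (objField d A) := by
  haveI : IsGalois ℚ_[p] (Fbar ℚ_[p]) := {}
  have hn : (objField d A).fixingSubgroup.Normal := by
    change (fixFld ℚ_[p] (objConnected d A)).fixingSubgroup.Normal
    rw [fixingSubgroup_fixFld]
    exact normal_stabilizerSubgroup_toConnected (isTempered_galFbar ℚ_[p]) A.base hA _
  exact (InfiniteGalois.normal_iff_isGalois _).mp hn

/-- … in particular normal over `ℚ_p`. [cite: MochizukiFrdII2008, Def 2.2 (ii) p.17] -/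
theorem normal_objField (hA : A.base.sg.toSubgroup.Normal) : Normal ℚ_[p] (objField d A) :=
  haveI := isGalois_objField d A hA
  inferInstance

/-! ### `χ : K_A ≅ ℚ̄_p^U` from `hd` -/

/-- The identification of base objects carried by `hd`. [cite: MochizukiFrdII2008, Def 2.2 (i) p.17] -/
def baseObjIso : d.base.obj A.base ≅ (galoisCosetBase p).obj A.base := eqToIso (by rw [hd])

omit [Fact p.Prime] in
/-- `e.inv.alg (e.hom.alg z) = z` for an isomorphism of `D₀`. [cite: MochizukiFrdII2008, Ex 1.1 (i) p.7] -/
theorem alg_inv_hom_apply {X Y : PadicFld.{0} p} (e : X ≅ Y) (z : Y.K) : e.inv.alg (e.hom.alg z) = z := by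
  have h := congrArg (fun k : Y ⟶ Y => k.alg z) e.inv_hom_id
  simpa only [PadicFld.comp_alg, PadicFld.id_alg, RingHom.comp_apply, RingHom.id_apply] using h

omit [Fact p.Prime] in
/-- `e.hom.alg (e.inv.alg x) = x` for an isomorphism of `D₀`. [cite: MochizukiFrdII2008, Ex 1.1 (i) p.7] -/
theorem alg_hom_inv_apply {X Y : PadicFld.{0} p} (e : X ≅ Y) (x : X.K) : e.hom.alg (e.inv.alg x) = x := by
  have h := congrArg (fun k : X ⟶ X => k.alg x) e.hom_inv_id
  simpa only [PadicFld.comp_alg, PadicFld.id_alg, RingHom.comp_apply, RingHom.id_apply] using h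

/-- `d.base.map g` read through the identification: `χ ∘ (d.base.map g).alg = (base₀.map g).alg ∘ χ`
(`Functor.congr_hom hd`). [cite: MochizukiFrdII2008, Def 2.2 (i) p.17] -/
theorem base_map_alg (g : A.base ⟶ A.base) (x : d.fld A.base) :
    (baseObjIso d hd A).inv.alg ((d.base.map g).alg x) =
      ((galoisCosetBase p).map g).alg ((baseObjIso d hd A).inv.alg x) := by
  rw [Functor.congr_hom hd g, PadicFld.comp_alg, PadicFld.comp_alg, RingHom.comp_apply, RingHom.comp_apply]
  exact alg_inv_hom_apply (baseObjIso d hd A) _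

/-- **`χ : K_A ≅ ℚ̄_p^U`** (ring isomorphism). [cite: MochizukiFrdII2008, Rmk 2.2.1 p.18] -/
def objFieldEquiv : d.fld A.base ≃+* objField d A :=
  { toFun := (baseObjIso d hd A).inv.alg
    invFun := (baseObjIso d hd A).hom.alg
    left_inv := fun x => alg_hom_inv_apply (baseObjIso d hd A) x
    right_inv := fun y => alg_inv_hom_apply (baseObjIso d hd A) y
    map_mul' := fun x y => map_mul _ x y
    map_add' := fun x y => map_add _ x y }

/-- Unfolding `objFieldEquiv`. [cite: MochizukiFrdII2008, Rmk 2.2.1 p.18] -/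
theorem objFieldEquiv_apply (x : d.fld A.base) : objFieldEquiv d hd A x = (baseObjIso d hd A).inv.alg x := rfl

/-! ### `res : Aut_C(A) → Gal(K_A/ℚ_p)` -/

/-- The `ℚ_p`-algebra endomorphism `a ↦ g·a` of `K_A` attached to `g : A_D → A_D` (abc-iut's
`QuasiTemperoid.galoisFields`). [cite: MochizukiFrdII2008, Def 2.2 (i) p.17] -/
def fieldAlgHom (g : A.base ⟶ A.base) : objField d A →ₐ[ℚ_[p]] objField d A :=
  ((galoisFields ℚ_[p]).map ((CosetCat.toConnected (isTempered_galFbar ℚ_[p])).map g)).alg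

/-- It is the ring map of `base₀.map g`. [cite: MochizukiFrdII2008, Def 2.2 (i) p.17] -/
theorem fieldAlgHom_toRingHom (g : A.base ⟶ A.base) :
    (fieldAlgHom d A g).toRingHom = ((galoisCosetBase p).map g).alg := rfl

/-- It is bijective (`K_A/ℚ_p` algebraic). [cite: MochizukiFrdII2008, Def 2.2 (i) p.17] -/
theorem fieldAlgHom_bijective (g : A.base ⟶ A.base) : Bijective (fieldAlgHom d A g) :=
  haveI := finiteDimensional_objField d A
  Algebra.IsAlgebraic.algHom_bijective _

/-- `fieldAlgHom (𝟙) = id`. [cite: MochizukiFrdII2008, Def 2.2 (i) p.17] -/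
theorem fieldAlgHom_id : fieldAlgHom d A (𝟙 A.base) = AlgHom.id ℚ_[p] (objField d A) := by
  rw [fieldAlgHom, CategoryTheory.Functor.map_id, CategoryTheory.Functor.map_id, FinEtale.id_alg]
  rfl

/-- `fieldAlgHom (g ≫ g') = fieldAlgHom g ∘ fieldAlgHom g'` (contravariance of `Spec`).
[cite: MochizukiFrdII2008, Def 2.2 (i) p.17] -/
theorem fieldAlgHom_comp (g g' : A.base ⟶ A.base) :
    fieldAlgHom d A (g ≫ g') = (fieldAlgHom d A g).comp (fieldAlgHom d A g') := by
  rw [fieldAlgHom, CategoryTheory.Functor.map_comp, CategoryTheory.Functor.map_comp, FinEtale.comp_alg]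
  rfl

/-- **`res : Aut_C(A) → Gal(K_A/ℚ_p)`**, `α ↦` the field automorphism of `Base(α⁻¹)`.
[cite: MochizukiFrdII2008, Def 2.2 (i) p.17] -/
def resAut : Aut A →* (objField d A ≃ₐ[ℚ_[p]] objField d A) where
  toFun α := AlgEquiv.ofBijective (fieldAlgHom d A (ModelFrobenioid.baseMap α.inv)) (fieldAlgHom_bijective d A _)
  map_one' := by
    apply AlgEquiv.ext
    intro a
    change fieldAlgHom d A (ModelFrobenioid.baseMap (1 : Aut A).inv) a = a
    have h1 : (1 : Aut A).inv = 𝟙 A := rfl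
    rw [h1, ModelFrobenioid.baseMap_id, fieldAlgHom_id]
    rfl
  map_mul' x y := by
    apply AlgEquiv.ext
    intro a
    change fieldAlgHom d A (ModelFrobenioid.baseMap (x * y).inv) a =
      fieldAlgHom d A (ModelFrobenioid.baseMap x.inv) (fieldAlgHom d A (ModelFrobenioid.baseMap y.inv) a)
    have hxy : (x * y).inv = x.inv ≫ y.inv := rfl
    rw [hxy, ModelFrobenioid.baseMap_comp, fieldAlgHom_comp]
    rfl

/-- Unfolding `resAut` on elements. [cite: MochizukiFrdII2008, Def 2.2 (i) p.17] -/
theorem resAut_apply (α : Aut A) (a : objField d A) :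
    resAut d A α a = fieldAlgHom d A (ModelFrobenioid.baseMap α.inv) a := rfl

/-- `res_apply` for the chart: `res α (χ x) = χ ((Base α⁻¹)^♯ x)`. [cite: MochizukiFrdII2008, Def 2.2 (i) p.17] -/
theorem resAut_objFieldEquiv (α : Aut A) (x : d.fld A.base) :
    resAut d A α (objFieldEquiv d hd A x) = objFieldEquiv d hd A ((d.toBaseZero.map α.inv).alg x) := by
  rw [resAut_apply, objFieldEquiv_apply, objFieldEquiv_apply]
  change ((fieldAlgHom d A (ModelFrobenioid.baseMap α.inv)).toRingHom) _ =
    (baseObjIso d hd A).inv.alg ((d.base.map (ModelFrobenioid.baseMap α.inv)).alg x)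
  rw [fieldAlgHom_toRingHom, base_map_alg]
  rfl

/-! ### Surjectivity: the Galois correspondence and `Aut`-ampleness -/

/-- Every `σ ∈ Gal(K_A/ℚ_p)` is the field map of an endomorphism `g` of `A_D = G_{ℚ_p}/U` (`galoisFields` is FULL,
the bridge `CosetCat.toConnected` is full). [cite: MochizukiFrdII2008, Def 2.2 (i) p.17] -/
theorem exists_fieldAlgHom_eq (σ : objField d A →ₐ[ℚ_[p]] objField d A) :
    ∃ g : A.base ⟶ A.base, fieldAlgHom d A g = σ := by
  haveI := galoisFields_full (F := ℚ_[p])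
  haveI := CosetCat.toConnected_full (isTempered_galFbar ℚ_[p])
  let φ : (galoisFields ℚ_[p]).obj (objConnected d A) ⟶ (galoisFields ℚ_[p]).obj (objConnected d A) := ⟨σ⟩
  refine ⟨(CosetCat.toConnected (isTempered_galFbar ℚ_[p])).preimage ((galoisFields ℚ_[p]).preimage φ), ?_⟩
  rw [fieldAlgHom, Functor.map_preimage, Functor.map_preimage]

/-- Endomorphisms of `A_D` with the same field map agree (faithfulness of `galoisFields` and of the bridge).
[cite: MochizukiFrdII2008, Def 2.2 (i) p.17] -/
theorem eq_of_fieldAlgHom_eq {g g' : A.base ⟶ A.base} (h : fieldAlgHom d A g = fieldAlgHom d A g') : g = g' := by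
  haveI := galoisFields_faithful (F := ℚ_[p])
  haveI := CosetCat.toConnected_faithful (isTempered_galFbar ℚ_[p])
  apply (CosetCat.toConnected (isTempered_galFbar ℚ_[p])).map_injective
  apply (galoisFields ℚ_[p]).map_injective
  exact FinEtale.hom_ext h

/-- **`res` is surjective: "`G_A ⥲ Aut_E(A_E)`"** — every `σ ∈ Gal(K_A/ℚ_p)` lifts to an automorphism of
`A_D` (Galois correspondence) and then to `Aut_C(A)` (`C` is `Aut`-ample, [FrdII] Thm. 1.2 (i), abc-iut-L1-t4's
`thm12_isAutAmple`). [cite: MochizukiFrdII2008, Def 2.2 (i) p.17] -/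
theorem resAut_surjective : Surjective (resAut d A) := by
  intro σ
  obtain ⟨g₀, hg₀⟩ := exists_fieldAlgHom_eq d A (σ : objField d A →ₐ[ℚ_[p]] objField d A)
  obtain ⟨g₁, hg₁⟩ := exists_fieldAlgHom_eq d A (σ.symm : objField d A →ₐ[ℚ_[p]] objField d A)
  have h01 : g₀ ≫ g₁ = 𝟙 A.base := eq_of_fieldAlgHom_eq d A (by
    rw [fieldAlgHom_comp, hg₀, hg₁, fieldAlgHom_id]
    exact AlgHom.ext fun a => σ.apply_symm_apply a)
  have h10 : g₁ ≫ g₀ = 𝟙 A.base := eq_of_fieldAlgHom_eq d A (by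
    rw [fieldAlgHom_comp, hg₀, hg₁, fieldAlgHom_id]
    exact AlgHom.ext fun a => σ.symm_apply_apply a)
  -- the base automorphism with `hom := g₁`, `inv := g₀`, lifted by `Aut`-ampleness
  let G : A.base ≅ A.base := ⟨g₁, g₀, h10, h01⟩
  obtain ⟨α, hα⟩ := d.thm12_isAutAmple A G
  refine ⟨α, ?_⟩
  have hinv : ModelFrobenioid.baseMap α.inv = g₀ := by
    have := congrArg Iso.inv hα
    exact this
  apply AlgEquiv.ext
  intro a
  rw [resAut_apply, hinv, hg₀]
  rfl


/-- **`Ker(Aut_C(A) → Aut_E(A_E)) = O^×(A)`** for the base of §2: `res α = 1` iff `α` is a base-identity (linear)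
automorphism — the Galois correspondence is faithful on `Aut_D(A_D)` (the chart property `hker` consumed by file D4).
[cite: MochizukiFrdII2008, Def 2.2 (i) p.17] -/
theorem resAut_eq_one_iff (α : Aut A) :
    resAut d A α = 1 ↔ α.hom ∈ PreFrobenioid.endSubmonoid d.structureFunctor A := by
  rw [ModelFrobenioid.mem_endSubmonoid_iff]
  constructor
  · intro h
    have hinv : ModelFrobenioid.baseMap α.inv = 𝟙 A.base := by
      apply eq_of_fieldAlgHom_eq d A
      rw [fieldAlgHom_id]
      apply AlgHom.ext
      intro a
      have := AlgEquiv.congr_fun h a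
      rw [resAut_apply] at this
      exact this
    refine ⟨?_, (ModelFrobenioid.degFr_hom_eq_one α).1⟩
    have h2 := ModelFrobenioid.baseMap_inv_comp_hom α
    rwa [hinv, Category.id_comp] at h2
  · rintro ⟨hb, -⟩
    have hinv : ModelFrobenioid.baseMap α.inv = 𝟙 A.base := by
      have h2 := ModelFrobenioid.baseMap_inv_comp_hom α
      rwa [hb, Category.comp_id] at h2
    apply AlgEquiv.ext
    intro a
    rw [resAut_apply, hinv, fieldAlgHom_id]
    rfl

/-! ### The chart -/

/-- **The Galois chart of an object of a `p`-adic Frobenioid over the base of §2** (`Π = G_{ℚ_p}`, small model):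
`K_A ≅ ℚ̄_p^U`, `res : Aut_C(A) ↠ Gal(ℚ̄_p^U/ℚ_p)`. [cite: MochizukiFrdII2008, Def 2.2 (i) p.17] -/
def galoisChartCoset : d.GaloisChart A ℚ_[p] (objField d A) where
  χ := objFieldEquiv d hd A
  res := resAut d A
  res_apply α x := congrArg (fun y : objField d A => (y : AlgebraicClosure ℚ_[p])) (resAut_objFieldEquiv d hd A α x)
  res_surjective := resAut_surjective d A


/-! ### The Definition 2.2 context of an object over the base of §2, and Theorem 2.4 (i) for such objects -/

/-- **Definition 2.2 for an object `A` (with `A_D = G_{ℚ_p}/U`, `U` normal) of a `p`-adic Frobenioid over the base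
`B(G_{ℚ_p})⁰ → D₀` of §2** and an open normal `H ⊆ G_{ℚ_p}`: the context `Def22Context.ofChart` (file D3) of the
chart `galoisChartCoset` — `Aut_C(A)` ↷ `O^▷(A)`, `Aut_E(A_E) = Gal(ℚ̄_p^U/ℚ_p)`, `G = G_{ℚ_p} ⊇ H`.
[cite: MochizukiFrdII2008, Def 2.2 (i) p.17] -/
abbrev contextOfObject (hA : A.base.sg.toSubgroup.Normal) (H : Subgroup (absoluteGaloisGroup ℚ_[p])) [H.Normal]
    (hH : IsOpen (H : Set (absoluteGaloisGroup ℚ_[p]))) : PadicKummer.Def22Context :=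
  haveI := finiteDimensional_objField d A
  haveI := normal_objField d A hA
  PadicKummer.Def22Context.ofChart (galoisChartCoset d hd A) H hH

/-- `H` is locally compact for the object's context (discharges the instance hypothesis of `thm24i_ofObjects`).
[cite: MochizukiFrdII2008, Def 2.2 (i) p.17] -/
theorem locallyCompactSpace_H_contextOfObject (hA : A.base.sg.toSubgroup.Normal)
    (H : Subgroup (absoluteGaloisGroup ℚ_[p])) [H.Normal] (hH : IsOpen (H : Set (absoluteGaloisGroup ℚ_[p]))) :
    LocallyCompactSpace (contextOfObject d hd A hA H hH).H :=
  haveI := finiteDimensional_objField d A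
  haveI := normal_objField d A hA
  PadicKummer.Def22Context.locallyCompactSpace_H_ofChart (p₁ := p) (galoisChartCoset d hd A)

end Datum

end PadicFrd

/-! ### Theorem 2.4 (i) for two objects over the bases of §2 -/

namespace PadicKummer.Def22Context

open CategoryTheory Field IntermediateField Kummer Function
open Literature.AnabelianGeometry.SemiGraphs QuasiTemperoid PadicFrd PadicFrd.Datum

variable {p₁ p₂ : ℕ} [Fact p₁.Prime] [Fact p₂.Prime]
  {d₁ : PadicFrd.Datum (CosetCat (GalFbar ℚ_[p₁])) p₁} (hd₁ : d₁.base = galoisCosetBase p₁) {A₁ : d₁.frobenioid}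
  (hA₁ : A₁.base.sg.toSubgroup.Normal)
  {d₂ : PadicFrd.Datum (CosetCat (GalFbar ℚ_[p₂])) p₂} (hd₂ : d₂.base = galoisCosetBase p₂) {A₂ : d₂.frobenioid}
  (hA₂ : A₂.base.sg.toSubgroup.Normal)
  {H₁ : Subgroup (absoluteGaloisGroup ℚ_[p₁])} [H₁.Normal] {hH₁ : IsOpen (H₁ : Set (absoluteGaloisGroup ℚ_[p₁]))}
  {H₂ : Subgroup (absoluteGaloisGroup ℚ_[p₂])} [H₂.Normal] {hH₂ : IsOpen (H₂ : Set (absoluteGaloisGroup ℚ_[p₂]))}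
  (e : Iso (contextOfObject d₁ hd₁ A₁ hA₁ H₁ hH₁) (contextOfObject d₂ hd₂ A₂ hA₂ H₂ hH₂)) (N : ℕ) [NeZero N]
  (hμ₁ : ∀ ζ : rootsOfUnity N (AlgebraicClosure ℚ_[p₁]),
    ((ζ : (AlgebraicClosure ℚ_[p₁])ˣ) : AlgebraicClosure ℚ_[p₁]) ∈ objField d₁ A₁)
  (hμ₂ : ∀ ζ : rootsOfUnity N (AlgebraicClosure ℚ_[p₂]),
    ((ζ : (AlgebraicClosure ℚ_[p₂])ˣ) : AlgebraicClosure ℚ_[p₂]) ∈ objField d₂ A₂)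
  [LocallyCompactSpace (contextOfObject d₁ hd₁ A₁ hA₁ H₁ hH₁).H]
  [LocallyCompactSpace (contextOfObject d₂ hd₂ A₂ hA₂ H₂ hH₂).H]

/-- **Theorem 2.4 (i) for two OBJECTS `Aᵢ` of `pᵢ`-adic Frobenioids over the bases `B(G_{ℚ_{pᵢ}})⁰ → D₀` of §2**
(`(Aᵢ)_D` Galois, `μ_N(ℚ̄_{pᵢ}) ⊆ K_{Aᵢ}`, `A₁` `(N, H₁)`-saturated, any normalisation `F_N(A₁) ≅ ℤ/N`) and any
isomorphism `e` of their Definition 2.2 contexts "induced by `Ψ`": the typed `Thm24i` with the cup-product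
duality isomorphisms holds — conditional on EXACTLY `hfs` ("`Φ₁` fieldwise saturated iff `Φ₂`", row L03); every
other input (charts, descended actions, `μ_N(Aᵢ) ≅ μ_N(ℚ̄_{pᵢ})`, `p₁ = p₂`, local Tate duality, saturation
transfer, Kummer/reciprocity compatibility) is CONSTRUCTED or PROVED. [cite: MochizukiFrdII2008, Thm 2.4 (i) p.19] -/
theorem thm24i_ofObjects (fs₁ fs₂ : Prop) (hfs : fs₁ ↔ fs₂)
    (eFN₁ : FN (contextOfObject d₁ hd₁ A₁ hA₁ H₁ hH₁) N ≃+ ZMod N)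
    (hc₁ : IsNHSaturated (contextOfObject d₁ hd₁ A₁ hA₁ H₁ hH₁) N) :
    haveI := finiteDimensional_objField d₁ A₁; haveI := normal_objField d₁ A₁ hA₁
    haveI := finiteDimensional_objField d₂ A₂; haveI := normal_objField d₂ A₂ hA₂
    letI := (galoisChartCoset d₁ hd₁ A₁).galAction; letI := (galoisChartCoset d₂ hd₂ A₂).galAction
    Thm24i (contextOfObject d₁ hd₁ A₁ hA₁ H₁ hH₁) (contextOfObject d₂ hd₂ A₂ hA₂ H₂ hH₂) N p₁ p₂ fs₁ fs₂
      (e.thm24Data N)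
      ((contextOfObject d₁ hd₁ A₁ hA₁ H₁ hH₁).dualityIsoOfLocalDuality N eFN₁ hc₁
        (cupDualH_bijective_ofGalois_mlf p₁ (objField d₁ A₁) H₁ hH₁ (galoisChartCoset d₁ hd₁ A₁).res
          (galoisChartCoset d₁ hd₁ A₁).res_smul ((galoisChartCoset d₁ hd₁ A₁).muModel N hμ₁)))
      ((contextOfObject d₂ hd₂ A₂ hA₂ H₂ hH₂).dualityIsoOfLocalDuality N ((e.isoFN N).symm.trans eFN₁)
        ((e.isNHSaturated_iff N).mp hc₁)
        (cupDualH_bijective_ofGalois_mlf p₂ (objField d₂ A₂) H₂ hH₂ (galoisChartCoset d₂ hd₂ A₂).res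
          (galoisChartCoset d₂ hd₂ A₂).res_smul ((galoisChartCoset d₂ hd₂ A₂).muModel N hμ₂))) :=
  haveI := finiteDimensional_objField d₁ A₁; haveI := normal_objField d₁ A₁ hA₁
  haveI := finiteDimensional_objField d₂ A₂; haveI := normal_objField d₂ A₂ hA₂
  thm24i_ofChart (galoisChartCoset d₁ hd₁ A₁) (galoisChartCoset d₂ hd₂ A₂) e N hμ₁ hμ₂ fs₁ fs₂ hfs eFN₁ hc₁

end PadicKummer.Def22Context

end Literature.AlgebraicGeometry.Frobenioids

end
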